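import Literature.AlgebraicGeometry.Modules.LineBundleOfCocycle
import Literature.AlgebraicGeometry.Modules.RankOneCocycle
import HarnessLib

/-!
# The glued line bundle has the prescribed cocycle class

Continuation of `Modules/LineBundleOfCocycle.lean`: for a cocycle of units `c = (U_x, g_{xy})` on a
scheme `X`, the local trivialisations `𝒪|_{U_z} ≅ (lineBundle c)|_{U_z}`, `r ↦ r t_z`, assemble to a
frame system of constant rank `1` of `lineBundle c` (`lineBundleFrameSystem`) whose determinant
cocycle IS `c` (`lineBundleFrameSystem_cocycle_g`, from `t_w = g_{zw} t_z`). Consequently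
`lineBundle c` is finite locally free of rank `1` (`hasRank_lineBundle`) and its determinant class is
the class of `c` (`detClass_lineBundle`): **every class in `Ȟ¹(X, 𝒪_X^×)` is the class of a line
bundle** (surjectivity in Hartshorne III Ex. 4.5). Also: the frame `𝒪^{PUnit} ≅ 𝒪|_U` of the
structure sheaf (`freePUnitIso`, basis section `1`). Everything is proved; no named facts.

## References

* R. Hartshorne, *Algebraic Geometry*, GTM 52 (1977), III Ex. 4.5. [Hartshorne1977]
-/

noncomputable section

open CategoryTheory AlgebraicGeometry Opposite TopologicalSpace Limits

namespace Literature.AlgebraicGeometry.Modules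

open Literature.AlgebraicGeometry.Motives

universe u

variable {X : Scheme.{u}}

/-! ### The one-element frame of the structure sheaf -/

section FreePUnit

/-- Composing a coprojection with the map out of a free module given by sections picks the
corresponding section. [folklore] -/
lemma ιFree_comp_freeHomEquiv_symm {C : Type*} [Category C] {J : GrothendieckTopology C}
    {R : Sheaf J RingCat.{u}} [HasWeakSheafify J AddCommGrpCat.{u}]
    [J.WEqualsLocallyBijective AddCommGrpCat.{u}] {M : SheafOfModules.{u} R} {I : Type u}
    (s : I → M.sections) (i : I) :
    SheafOfModules.ιFree i ≫ M.freeHomEquiv.symm s = M.unitHomEquiv.symm (s i) := by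
  apply M.unitHomEquiv.injective
  rw [Equiv.apply_symm_apply, ← freeHomEquiv_eq_unitHomEquiv, Equiv.apply_symm_apply]

variable (U : X.Opens)

/-- The coprojection of the single copy is inverse to the map `𝒪^{PUnit} → 𝒪|_U` given by the
unit section. [folklore] -/
lemma ιFree_comp_unitSectionHom :
    SheafOfModules.ιFree PUnit.unit ≫ ((unitModule X).over U).freeHomEquiv.symm
      (fun _ : PUnit.{u + 1} => ((unitModule X).over U).unitHomEquiv (𝟙 _)) = 𝟙 _ := by
  rw [ιFree_comp_freeHomEquiv_symm, Equiv.symm_apply_apply]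

/-- **The frame `𝒪^{PUnit} ≅ 𝒪|_U` of the structure sheaf over an open** (the coproduct of a single
copy of the unit), with basis section `1`. [folklore] -/
def freePUnitIso : SheafOfModules.free (PUnit : Type u) ≅ (unitModule X).over U where
  hom := ((unitModule X).over U).freeHomEquiv.symm
    fun _ : PUnit.{u + 1} => ((unitModule X).over U).unitHomEquiv (𝟙 _)
  inv := SheafOfModules.ιFree PUnit.unit
  hom_inv_id := by
    refine Cofan.IsColimit.hom_ext
      (SheafOfModules.isColimitFreeCofan (R := X.ringCatSheaf.over U) PUnit) _ _ fun j => ?_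
    obtain rfl : j = PUnit.unit := rfl
    have h := congrArg (fun φ => φ ≫ SheafOfModules.ιFree (R := X.ringCatSheaf.over U)
      (I := PUnit.{u + 1}) PUnit.unit) (ιFree_comp_unitSectionHom U)
    rw [SheafOfModules.freeCofan_inj]
    exact (Category.assoc _ _ _).symm.trans
      (h.trans ((Category.id_comp _).trans (Category.comp_id _).symm))
  inv_hom_id := ιFree_comp_unitSectionHom U

/-- The basis section of `freePUnitIso U` is `1 ∈ Γ(X, U)`. [folklore] -/
theorem one_eq_basisSection_freePUnitIso :
    (1 : Γ(X, U)) = basisSection (E := unitModule X) (freePUnitIso U) PUnit.unit := by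
  change (1 : Γ(X, U)) = Scheme.Modules.overSectionsEquiv (unitModule X) U
    (((unitModule X).over U).freeHomEquiv (((unitModule X).over U).freeHomEquiv.symm _) _)
  rw [Equiv.apply_symm_apply]
  rfl

end FreePUnit

/-! ### The frame system of the glued line bundle -/

namespace UnitCocycle

variable (c : UnitCocycle X)

/-- **The frame of `lineBundle c` at `z`**: `𝒪^{PUnit} ≅ 𝒪|_{U_z} ≅ (lineBundle c)|_{U_z}`.
[folklore] -/
def lineBundleFrame (z : X) : SheafOfModules.free (PUnit : Type u) ≅ (lineBundle c).over (c.U z) :=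
  freePUnitIso (c.U z) ≪≫ c.lineBundleTriv z

/-- The basis section of the frame at `z` is the local generator `t_z`. [folklore] -/
theorem basisSection_lineBundleFrame (z : X) :
    basisSection (E := lineBundle c) (c.lineBundleFrame z) PUnit.unit =
      c.lineBundleGen z (c.U z) le_rfl := by
  rw [basisSection, lineBundleFrame, Iso.trans_hom, SheafOfModules.freeHomEquiv_comp_apply,
    overSectionsEquiv_sectionsMap']
  change appLE (c.lineBundleTriv z).hom (𝟙 _) (basisSection (E := unitModule X)
    (freePUnitIso (c.U z)) PUnit.unit) = _
  rw [← one_eq_basisSection_freePUnitIso, appLE_lineBundleTriv_hom, one_smul]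

/-- **The frame system of the glued line bundle** (rank `1` everywhere). [folklore] -/
def lineBundleFrameSystem : FrameSystem (lineBundle c) where
  U := c.U
  mem := c.mem
  I _ := PUnit
  rank _ := 1
  enum _ := _root_.Equiv.ofUnique PUnit (Fin 1)
  frame z := c.lineBundleFrame z

/-- The frame system of the glued line bundle has rank `1` everywhere. [folklore] -/
lemma lineBundleFrameSystem_rank (x : X) : c.lineBundleFrameSystem.rank x = 1 := rfl

/-- **The determinant cocycle of the glued line bundle is the cocycle** (from `t_w = g_{zw} t_z`).
[folklore] -/
theorem lineBundleFrameSystem_cocycle_g (z w : X) (V : X.Opens) (hz : V ≤ c.U z) (hw : V ≤ c.U w) :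
    c.lineBundleFrameSystem.cocycle.g z w V hz hw = c.g z w V hz hw := by
  classical
  rw [FrameSystem.cocycle_g]
  change transitionDet (c.lineBundleFrame z) (c.lineBundleFrame w) _ _ (homOfLE hz) (homOfLE hw) = _
  rw [transitionDet_eq_of_subsingleton _ _ _ _ _ _ PUnit.unit PUnit.unit, transition_apply,
    basisSection_lineBundleFrame, map_lineBundleGen,
    c.lineBundleGen_eq_smul z w V hz hw]
  rw [coord_smul, ← c.map_lineBundleGen z le_rfl (homOfLE hz), ← basisSection_lineBundleFrame,
    coord_map_basisSection, if_pos rfl, mul_one]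

/-- The cocycle of the frame system of `lineBundle c` has the class of `c`. [folklore] -/
theorem mk_lineBundleFrameSystem_cocycle :
    CechPic.mk c.lineBundleFrameSystem.cocycle = CechPic.mk c :=
  CechPic.sound (UnitCocycle.equiv_of_eq _ _ c.U c.mem (fun _ => le_rfl) (fun _ => le_rfl)
    fun z w V hz hw => (c.lineBundleFrameSystem_cocycle_g z w V hz hw).symm)

/-- The glued line bundle is finite locally free. [folklore] -/
theorem isFiniteLocallyFree_lineBundle : IsFiniteLocallyFree (lineBundle c) :=
  c.lineBundleFrameSystem.isFiniteLocallyFree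

/-- **The glued line bundle has rank `1`.** [folklore] -/
theorem hasRank_lineBundle : HasRank (lineBundle c) 1 :=
  c.lineBundleFrameSystem.hasRank 1 fun _ => rfl

/-- **The determinant class of the glued line bundle is the class of the cocycle**: every class in
`Ȟ¹(X, 𝒪_X^×)` is the determinant class of a line bundle (Hartshorne III Ex. 4.5, surjectivity).
[cite: Hartshorne1977, III Ex. 4.5] -/
theorem detClass_lineBundle : detClass c.isFiniteLocallyFree_lineBundle = CechPic.mk c := by
  rw [detClass_eq_mk _ c.lineBundleFrameSystem, mk_lineBundleFrameSystem_cocycle]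

end UnitCocycle

end Literature.AlgebraicGeometry.Modules

end
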